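import Literature.RingTheory.MvPowerSeries.ConvergentNoetherian
import Mathlib.RingTheory.AdicCompletion.Noetherian
import HarnessLib

/-!
# Ideals of `𝕜{x}` are closed; series of high order lie in high powers of the maximal ideal

Topic `Literature/RingTheory/MvPowerSeries`.  Two consequences of the Rückert basis theorem
(`convergent.isNoetherianRing`, file `ConvergentNoetherian.lean`) for the local ring
`𝕜{x} = convergent σ 𝕜` (finitely many variables, `𝕜` an infinite complete normed field) with
maximal ideal `𝔪 = {f | f(0) = 0}`:

* **Krull: ideals are `𝔪`-adically closed** (`Ideal.mem_of_forall_sub_mem_pow`): if for every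
  `n` there is `i ∈ I` with `f - i ∈ 𝔪ⁿ`, then `f ∈ I` (Krull's intersection theorem for the
  finite module `𝕜{x}/I`, Mathlib's `IsHausdorff (maximalIdeal R) M`).
* **Order and powers of `𝔪`** (`mem_maximalIdeal_pow_of_coeff_eq_zero`): a convergent series all
  of whose coefficients of total degree `< n` vanish lies in `𝔪ⁿ` — it is `∑_{|β| = n} x^β g_β`
  with CONVERGENT `g_β` (`exists_eq_sum_monomial_mul`).

These are the two ingredients of the Denef–van den Dries finiteness lemma
(`FinitenessProperty.lean`).  Everything is proved; no named facts.

## References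

* H. Grauert, R. Remmert, *Analytische Stellenalgebren*, Springer (1971), Kap. I §5
  (Rückertscher Basissatz, Krullscher Durchschnittssatz). [GrauertRemmert1971]
* J. Denef, L. van den Dries, *p-adic and real subanalytic sets*, Ann. of Math. 128 (1988), §4.
  [DenefvandenDries1988]
-/

noncomputable section

open MvPowerSeries Finsupp Filter Function
open scoped NNReal ENNReal Topology BigOperators

namespace Literature.RingTheory.MvPowerSeries

universe u

variable {σ : Type u} {𝕜 : Type*} [NormedField 𝕜]

/-! ### 1. Ideals are closed in the `𝔪`-adic topology -/

section Closed

variable [Finite σ] [CompleteSpace 𝕜] [Infinite 𝕜]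

set_option synthInstance.maxHeartbeats 200000 in
-- (the scalar action of `𝕜{x}` on `𝕜{x} ⧸ I` is found through the subalgebra tower; slow)
/-- **Ideals of `𝕜{x}` are `𝔪`-adically closed** (Krull): if `f` is approximable from `I`
modulo every power of the maximal ideal, then `f ∈ I`.
[cite: GrauertRemmert1971, Kap. I §5] -/
theorem Ideal.mem_of_forall_sub_mem_pow (I : Ideal (convergent σ 𝕜)) (f : convergent σ 𝕜)
    (h : ∀ n : ℕ, ∃ i ∈ I, f - i ∈ (IsLocalRing.maximalIdeal (convergent σ 𝕜)) ^ n) : f ∈ I := by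
  haveI : IsNoetherianRing (convergent σ 𝕜) := convergent.isNoetherianRing (𝕜 := 𝕜) σ
  -- Krull on the finite module `𝕜{x} ⧸ I`
  have hH : IsHausdorff (IsLocalRing.maximalIdeal (convergent σ 𝕜)) (convergent σ 𝕜 ⧸ I) :=
    inferInstance
  rw [← Ideal.Quotient.eq_zero_iff_mem]
  refine hH.haus _ fun n => ?_
  rw [SModEq.zero]
  obtain ⟨i, hi, hfi⟩ := h n
  have h1 : Ideal.Quotient.mk I f = (f - i) • (1 : convergent σ 𝕜 ⧸ I) := by
    have h2 : (1 : convergent σ 𝕜 ⧸ I) = Ideal.Quotient.mk I 1 := (map_one _).symm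
    rw [h2]
    conv_rhs => rw [← Ideal.Quotient.mk_eq_mk, ← Submodule.Quotient.mk_smul, smul_eq_mul, mul_one,
      Ideal.Quotient.mk_eq_mk]
    rw [Ideal.Quotient.eq]
    simpa using hi
  rw [h1]
  exact Submodule.smul_mem_smul hfi Submodule.mem_top

end Closed

/-! ### 2. Series of order `≥ n` lie in `𝔪ⁿ` -/

section Order

/-- Below a multi-index of degree `≥ n` there is one of degree exactly `n`. [folklore] -/
theorem exists_le_degree_eq {α : σ →₀ ℕ} {n : ℕ} (h : n ≤ α.degree) :
    ∃ β : σ →₀ ℕ, β ≤ α ∧ β.degree = n := by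
  classical
  induction n with
  | zero => exact ⟨0, zero_le, by simp⟩
  | succ n ih =>
    obtain ⟨β, hβα, hβn⟩ := ih (Nat.le_of_succ_le h)
    -- some coordinate of `β` is strictly below that of `α`
    have hne : β ≠ α := by
      rintro rfl; omega
    obtain ⟨i, hi⟩ : ∃ i, β i < α i := by
      by_contra hcon
      push Not at hcon
      exact hne (le_antisymm hβα fun i => hcon i)
    refine ⟨β + single i 1, fun j => ?_, by rw [map_add, hβn, Finsupp.degree_single]⟩
    by_cases hj : j = i
    · subst hj
      simp only [Finsupp.coe_add, Pi.add_apply, Finsupp.single_eq_same]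
      omega
    · rw [Finsupp.add_apply, Finsupp.single_apply, if_neg (fun h => hj h.symm), add_zero]
      exact hβα j

/-- Degree is monotone. [folklore] -/
theorem degree_le_of_le {β α : σ →₀ ℕ} (h : β ≤ α) : β.degree ≤ α.degree := by
  have : α = β + (α - β) := (add_tsub_cancel_of_le h).symm
  rw [this, map_add]
  exact Nat.le_add_right _ _

/-- A choice of a degree-`n` multi-index below `α` (junk `0` when `|α| < n`). [folklore] -/
def pickBelow (n : ℕ) (α : σ →₀ ℕ) : σ →₀ ℕ :=
  if h : n ≤ α.degree then Classical.choose (exists_le_degree_eq h) else 0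

/-- Specification of `pickBelow`. [folklore] -/
theorem pickBelow_spec {n : ℕ} {α : σ →₀ ℕ} (h : n ≤ α.degree) :
    pickBelow n α ≤ α ∧ (pickBelow n α).degree = n := by
  rw [pickBelow, dif_pos h]
  exact Classical.choose_spec (exists_le_degree_eq h)

open scoped Classical in
/-- The `x^β`-cofactor of `f` collecting the monomials `α` with `pickBelow n α = β`.
[cite: GrauertRemmert1971, Kap. I §5] -/
def cofactor (n : ℕ) (β : σ →₀ ℕ) (f : MvPowerSeries σ 𝕜) : MvPowerSeries σ 𝕜 :=
  fun γ => if pickBelow n (γ + β) = β then coeff (γ + β) f else 0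

open scoped Classical in
/-- Coefficients of `cofactor`. [folklore] -/
@[simp] theorem coeff_cofactor (n : ℕ) (β : σ →₀ ℕ) (f : MvPowerSeries σ 𝕜) (γ : σ →₀ ℕ) :
    coeff γ (cofactor n β f) = if pickBelow n (γ + β) = β then coeff (γ + β) f else 0 := rfl

/-- **Cofactors are dominated**: `‖cofactor n β f‖_ρ ρ^β ≤ ‖f‖_ρ`. [folklore] -/
theorem wnorm_cofactor_mul_le (ρ : σ → ℝ≥0) (n : ℕ) (β : σ →₀ ℕ) (f : MvPowerSeries σ 𝕜) :
    wnorm ρ (cofactor n β f) * wt ρ β ≤ wnorm ρ f := by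
  unfold wnorm
  rw [← ENNReal.tsum_mul_right]
  calc ∑' γ, ((‖coeff γ (cofactor n β f)‖₊ * wt ρ γ : ℝ≥0) : ℝ≥0∞) * wt ρ β
      ≤ ∑' γ, ((‖coeff (γ + β) f‖₊ * wt ρ (γ + β) : ℝ≥0) : ℝ≥0∞) := by
        refine ENNReal.tsum_le_tsum fun γ => ?_
        rw [← ENNReal.coe_mul, ENNReal.coe_le_coe, mul_assoc, ← wt_add, coeff_cofactor]
        split_ifs
        · exact le_rfl
        · simp
    _ ≤ ∑' e, ((‖coeff e f‖₊ * wt ρ e : ℝ≥0) : ℝ≥0∞) :=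
        ENNReal.tsum_comp_le_tsum_of_injective (add_left_injective β) _

/-- Cofactors of convergent series are convergent. [folklore] -/
theorem HasPosRadius.cofactor (n : ℕ) (β : σ →₀ ℕ) {f : MvPowerSeries σ 𝕜} (hf : HasPosRadius f) :
    HasPosRadius (cofactor n β f) := by
  obtain ⟨ρ, hρ, hfin⟩ := hf
  refine ⟨ρ, hρ, ?_⟩
  have hb : (wt ρ β : ℝ≥0∞) ≠ 0 := ENNReal.coe_ne_zero.mpr (wt_pos hρ β).ne'
  refine lt_of_le_of_lt ?_ (ENNReal.div_lt_top hfin.ne hb)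
  rw [ENNReal.le_div_iff_mul_le (Or.inl hb) (Or.inl ENNReal.coe_ne_top)]
  exact wnorm_cofactor_mul_le ρ n β f

/-- A monomial `x^β`, as an element of `𝕜{x}`, lies in `𝔪^{|β|}`. [folklore] -/
theorem monomial_mem_maximalIdeal_pow (β : σ →₀ ℕ) :
    (⟨monomial β (1 : 𝕜), HasPosRadius.monomial β 1⟩ : convergent σ 𝕜) ∈
      (IsLocalRing.maximalIdeal (convergent σ 𝕜)) ^ β.degree := by
  classical
  -- `x^β = ∏ᵢ (x_i)^{βᵢ}` in `𝕜{x}`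
  set Xc : σ → convergent σ 𝕜 := fun i => ⟨X i, HasPosRadius.X i⟩
  have hprod : (⟨monomial β (1 : 𝕜), HasPosRadius.monomial β 1⟩ : convergent σ 𝕜) =
      ∏ i ∈ β.support, Xc i ^ β i := by
    apply Subtype.ext
    push_cast
    rw [MvPowerSeries.monomial_one_eq]
    rfl
  rw [hprod, Finsupp.degree_apply]
  -- induction over the support
  have key : ∀ s : Finset σ, (∏ i ∈ s, Xc i ^ β i) ∈
      (IsLocalRing.maximalIdeal (convergent σ 𝕜)) ^ (∑ i ∈ s, β i) := by
    intro s
    induction s using Finset.induction_on with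
    | empty => simp
    | insert a s ha ih =>
      rw [Finset.prod_insert ha, Finset.sum_insert ha, pow_add]
      exact Ideal.mul_mem_mul (Ideal.pow_mem_pow (X_mem_maximalIdeal a) _) ih
  exact key _

variable [Finite σ]

/-- The finite set of multi-indices of degree exactly `n`. [folklore] -/
def degreeEq (n : ℕ) : Finset (σ →₀ ℕ) :=
  ((Finsupp.finite_of_degree_le (σ := σ) n).toFinset).filter fun β => β.degree = n

/-- Membership in `degreeEq`. [folklore] -/
@[simp] theorem mem_degreeEq {n : ℕ} {β : σ →₀ ℕ} : β ∈ degreeEq n ↔ β.degree = n := by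
  simp only [degreeEq, Finset.mem_filter, Set.Finite.mem_toFinset, Set.mem_setOf_eq]
  exact ⟨fun h => h.2, fun h => ⟨h.le, h⟩⟩

/-- **A series of order `≥ n` is a combination of the degree-`n` monomials with convergence-
preserving cofactors**: `f = ∑_{|β| = n} x^β · cofactor n β f`.
[cite: GrauertRemmert1971, Kap. I §5] -/
theorem eq_sum_monomial_mul_cofactor {n : ℕ} {f : MvPowerSeries σ 𝕜}
    (h : ∀ α : σ →₀ ℕ, α.degree < n → coeff α f = 0) :
    f = ∑ β ∈ degreeEq n, monomial β (1 : 𝕜) * cofactor n β f := by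
  classical
  ext α
  rw [map_sum]
  simp_rw [coeff_monomial_mul, one_mul, coeff_cofactor]
  by_cases hα : n ≤ α.degree
  · obtain ⟨hle, hdeg⟩ := pickBelow_spec hα
    rw [Finset.sum_eq_single (pickBelow n α)]
    · rw [if_pos hle, tsub_add_cancel_of_le hle, if_pos rfl]
    · intro β _ hne
      by_cases hβα : β ≤ α
      · rw [if_pos hβα, tsub_add_cancel_of_le hβα, if_neg (Ne.symm hne)]
      · rw [if_neg hβα]
    · intro hmem
      exact absurd (mem_degreeEq.mpr hdeg) hmem
  · rw [h α (not_le.mp hα)]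
    refine (Finset.sum_eq_zero fun β hβ => ?_).symm
    rw [if_neg]
    intro hβα
    have := degree_le_of_le hβα
    rw [mem_degreeEq.mp hβ] at this
    exact hα this

/-- **Series of order `≥ n` lie in `𝔪ⁿ`**: if all coefficients of `f ∈ 𝕜{x}` of total degree
`< n` vanish then `f ∈ 𝔪ⁿ`. [cite: GrauertRemmert1971, Kap. I §5] -/
theorem mem_maximalIdeal_pow_of_coeff_eq_zero (f : convergent σ 𝕜) (n : ℕ)
    (h : ∀ α : σ →₀ ℕ, α.degree < n → coeff α (f : MvPowerSeries σ 𝕜) = 0) :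
    f ∈ (IsLocalRing.maximalIdeal (convergent σ 𝕜)) ^ n := by
  classical
  have hsum := eq_sum_monomial_mul_cofactor (𝕜 := 𝕜) h
  have hf : f = ∑ β ∈ degreeEq n,
      (⟨monomial β (1 : 𝕜), HasPosRadius.monomial β 1⟩ : convergent σ 𝕜) *
        ⟨cofactor n β (f : MvPowerSeries σ 𝕜), f.2.cofactor n β⟩ := by
    apply Subtype.ext
    conv_lhs => rw [hsum]
    push_cast
    rfl
  rw [hf]
  refine Ideal.sum_mem _ fun β hβ => Ideal.mul_mem_right _ _ ?_
  have := monomial_mem_maximalIdeal_pow (𝕜 := 𝕜) β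
  rwa [mem_degreeEq.mp hβ] at this

end Order

end Literature.RingTheory.MvPowerSeries
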